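import Mathlib
import Literature.Analysis.ValidatedNumerics.ConeAlgebraSemilinearClosing
import Literature.Analysis.ValidatedNumerics.ConeAlgebraEvaluation
import HarnessLib

/-!
# Swap symmetry of cone series: real-valuedness of the represented function and of the certificate's zero

Topic `Literature/Analysis/ValidatedNumerics`.  In the cone Wiener algebra `W = ℓ¹_ϱ(ζ^a ζ̄^b)` of REAL
coefficient families (`WeightedWienerAlgebra.lean`, `ConeAlgebraEvaluation.lean`) a family represents a
real-valued function on the disk exactly when it is symmetric under the exponent swap `(a,b) ↦ (b,a)`
(Arioli–Koch: "`B_ρ` is the subspace of real-valued functions `u ∈ A_ρ`", coefficients with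
`A_{−m,n} = A_{m,n}`).  This file types:

* `swapIdx`, `IsSymm u` (`u_{ba} = u_{ab}`) and **`conj_eval` / `im_eval_eq_zero`**: a symmetric `u`
  represents a REAL function, `Im u(ζ) = 0`;
* the swap as a map `swapW : W → W` — additive, MULTIPLICATIVE (the Cauchy product is swap-equivariant),
  norm-preserving — and its commutation with the Dirichlet inverse `ConeSemilinear.dirInv`
  (`swapW_dirInv`: the kernel is swap-invariant, `dirichletInvKer_swap`);
* **`swapW_semilinMap`**: the (B-SL) map `F(x) = x − Δ_D⁻¹(v x + Σ c_k x^k) − g` is swap-equivariant when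
  `v, c_k, g` are symmetric, hence **`isSymm_of_unique_zero`**: the unique zero of `F` in a ball centred at a
  symmetric `x̄` (the conclusion of `ConeSemilinear.cone_existsUnique_zero_of_semilin`) is symmetric, and
  therefore represents a real-valued function (`im_eval_zero_eq_zero`) — the solution `U` the Grad–Shafranov
  client needs is the real function `eval x`, not merely its real part.

## Sources

[ArioliKoch2019] §3 eq. (3.3) and the sentence after it ("`B_ρ` is the subspace of real-valued functions
`u ∈ A_ρ`"; real coefficients with the symmetry `A_{−m,n} = A_{m,n}`, `B_{−m,n} = −B_{m,n}`), §4 Lemma 4.3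
(symmetry of the solution from symmetry of the data and uniqueness: "if `ū` is invariant under `S` and `M`
commutes with `S`, then the solution … is invariant under `S`") — here for the swap (complex conjugation)
symmetry instead of the rotations `S_n`.

## What is NOT covered

Other symmetries (rotations `S_n` of Lemma 4.3); the Liouville rewrite to `Δ*`; float model.

## Provenance

AI-produced formalisation (cell certnum, seat certnum-ode-2, 2026-08-27).
-/

set_option autoImplicit false

open scoped BigOperators
open Complex

noncomputable section

namespace Literature.Analysis.ValidatedNumerics

namespace ConeEval

open WeightedSeq WienerAlgebra ConeMonomial ConeSemilinear

variable {ϱ : ℝ}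

/-! ### §1. The exponent swap -/

/-- The exponent swap `(a, b) ↦ (b, a)` on `Fin 2 →₀ ℕ`.
[cite: ArioliKoch2019, §3 eq. (3.3) (the symmetry m ↦ −m of the coefficients of a real function)] -/
def swapIdx (n : Fin 2 →₀ ℕ) : Fin 2 →₀ ℕ :=
  Finsupp.equivFunOnFinite.symm fun i => n (Equiv.swap (0 : Fin 2) 1 i)

/-- [cite: ArioliKoch2019, §3 eq. (3.3)] -/
@[simp] theorem swapIdx_apply_zero (n : Fin 2 →₀ ℕ) : swapIdx n 0 = n 1 := by
  simp [swapIdx, Equiv.swap_apply_left]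

/-- [cite: ArioliKoch2019, §3 eq. (3.3)] -/
@[simp] theorem swapIdx_apply_one (n : Fin 2 →₀ ℕ) : swapIdx n 1 = n 0 := by
  simp [swapIdx, Equiv.swap_apply_right]

/-- The swap is an involution. [cite: ArioliKoch2019, §3 eq. (3.3)] -/
@[simp] theorem swapIdx_swapIdx (n : Fin 2 →₀ ℕ) : swapIdx (swapIdx n) = n := by
  ext i; fin_cases i <;> simp

/-- The swap is additive. [cite: ArioliKoch2019, §3 eq. (3.3)] -/
theorem swapIdx_add (p q : Fin 2 →₀ ℕ) : swapIdx (p + q) = swapIdx p + swapIdx q := by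
  ext i; fin_cases i <;> simp

/-- [cite: ArioliKoch2019, §3 eq. (3.3)] -/
@[simp] theorem swapIdx_zero : swapIdx 0 = 0 := by
  ext i; fin_cases i <;> simp

/-- The swap is injective. [cite: ArioliKoch2019, §3 eq. (3.3)] -/
theorem swapIdx_injective : Function.Injective swapIdx := fun p q h => by
  rw [← swapIdx_swapIdx p, h, swapIdx_swapIdx]

/-- The swap as an equivalence. [cite: ArioliKoch2019, §3 eq. (3.3)] -/
def swapEquiv : (Fin 2 →₀ ℕ) ≃ (Fin 2 →₀ ℕ) where
  toFun := swapIdx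
  invFun := swapIdx
  left_inv := swapIdx_swapIdx
  right_inv := swapIdx_swapIdx

/-- [cite: ArioliKoch2019, §3 eq. (3.3)] -/
@[simp] theorem swapEquiv_apply (n : Fin 2 →₀ ℕ) : swapEquiv n = swapIdx n := rfl

/-- `idx (swap n) = (n₁, n₀)`. [cite: ArioliKoch2019, §3 eq. (3.3)] -/
@[simp] theorem idx_swapIdx (n : Fin 2 →₀ ℕ) : idx (swapIdx n) = (idx n).swap := by
  simp [idx_apply, Prod.swap]

/-- The cone weight is swap-invariant. [cite: ArioliKoch2019, §3 eq. (3.2)] -/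
theorem coneWeight_swapIdx (hϱ : 1 ≤ ϱ) (n : Fin 2 →₀ ℕ) :
    (coneSubmultWeight hϱ).toFun (swapIdx n) = (coneSubmultWeight hϱ).toFun n := by
  rw [coneSubmultWeight_apply, coneSubmultWeight_apply, swapIdx_apply_zero, swapIdx_apply_one, add_comm]

/-- The basis swaps under complex conjugation: `conj (ζ^a ζ̄^b) = ζ^b ζ̄^a = M_{swap}(ζ)`.
[cite: ArioliKoch2019, §3 eq. (3.3)] -/
theorem conj_mono (n : Fin 2 →₀ ℕ) (ζ : ℂ) : starRingEnd ℂ (mono n ζ) = mono (swapIdx n) ζ := by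
  rw [mono_eq, mono_eq, swapIdx_apply_zero, swapIdx_apply_one, map_mul, map_pow, map_pow,
    Complex.conj_conj, mul_comm]

/-! ### §2. Symmetric families represent real functions -/

/-- Swap symmetry of a coefficient family: `u_{ba} = u_{ab}`.
[cite: ArioliKoch2019, §3 eq. (3.3) (A_{−m,n} = A_{m,n}: real-valued functions)] -/
def IsSymm {hϱ : 1 ≤ ϱ} (u : Wiener (coneSubmultWeight hϱ)) : Prop := ∀ n, cf u (swapIdx n) = cf u n

/-- **A symmetric family represents a real function:** `conj (u(ζ)) = u(ζ)`.
[cite: ArioliKoch2019, §3 eq. (3.3) and the following sentence ("B_ρ is the subspace of real-valued functions")] -/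
theorem conj_eval (hϱ : 1 ≤ ϱ) {u : Wiener (coneSubmultWeight hϱ)} (hu : IsSymm u) (ζ : ℂ) :
    starRingEnd ℂ (eval hϱ u ζ) = eval hϱ u ζ := by
  unfold eval
  have h1 : starRingEnd ℂ (∑' n, (cf u n : ℂ) * mono n ζ) = ∑' n, (cf u n : ℂ) * mono (swapIdx n) ζ := by
    rw [show starRingEnd ℂ (∑' n, (cf u n : ℂ) * mono n ζ) = Complex.conjCLE (∑' n, (cf u n : ℂ) * mono n ζ)
      from rfl, ContinuousLinearEquiv.map_tsum]
    refine tsum_congr fun n => ?_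
    show starRingEnd ℂ ((cf u n : ℂ) * mono n ζ) = _
    rw [map_mul, Complex.conj_ofReal, conj_mono]
  rw [h1]
  -- reindex by the swap and use the symmetry of the coefficients
  calc ∑' n, (cf u n : ℂ) * mono (swapIdx n) ζ
      = ∑' n, (cf u (swapIdx n) : ℂ) * mono (swapIdx (swapIdx n)) ζ :=
        (swapEquiv.tsum_eq (fun n => (cf u n : ℂ) * mono (swapIdx n) ζ)).symm
    _ = ∑' n, (cf u n : ℂ) * mono n ζ := tsum_congr fun n => by rw [hu n, swapIdx_swapIdx]

/-- Hence `Im u(ζ) = 0` for a symmetric family. [cite: ArioliKoch2019, §3 eq. (3.3)] -/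
theorem im_eval_eq_zero (hϱ : 1 ≤ ϱ) {u : Wiener (coneSubmultWeight hϱ)} (hu : IsSymm u) (ζ : ℂ) :
    (eval hϱ u ζ).im = 0 :=
  Complex.conj_eq_iff_im.1 (conj_eval hϱ hu ζ)

/-! ### §3. The swap as a map of the algebra -/

/-- Summability of a family transported along the swap. [cite: ArioliKoch2019, §3 eq. (3.2)–(3.3)] -/
theorem mem_swap (hϱ : 1 ≤ ϱ) (u : Wiener (coneSubmultWeight hϱ)) :
    Mem (coneSubmultWeight hϱ).toFun (fun n => cf u (swapIdx n)) := by
  have h := mem_cf u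
  unfold Mem at h ⊢
  have e : (fun n => |cf u (swapIdx n)| * (coneSubmultWeight hϱ).toFun n)
      = (fun n => |cf u n| * (coneSubmultWeight hϱ).toFun n) ∘ swapEquiv := by
    funext n
    simp only [Function.comp_apply, swapEquiv_apply, coneWeight_swapIdx]
  rw [e]
  exact (swapEquiv.summable_iff).2 h

/-- **The swap `σ : W → W`**, `(σu)_{ab} = u_{ba}`.
[cite: ArioliKoch2019, §3 eq. (3.3); §4 Lemma 4.3 (the symmetry S acting on B_ρ)] -/
def swapW (hϱ : 1 ≤ ϱ) (u : Wiener (coneSubmultWeight hϱ)) : Wiener (coneSubmultWeight hϱ) :=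
  ⟨(fun n => cf u (swapIdx n) : MvPowerSeries (Fin 2) ℝ), mem_swap hϱ u⟩

/-- Coefficients of the swapped family. [cite: ArioliKoch2019, §3 eq. (3.3)] -/
@[simp] theorem cf_swapW (hϱ : 1 ≤ ϱ) (u : Wiener (coneSubmultWeight hϱ)) (n : Fin 2 →₀ ℕ) :
    cf (swapW hϱ u) n = cf u (swapIdx n) := rfl

/-- `u` is symmetric iff `σu = u`. [cite: ArioliKoch2019, §3 eq. (3.3)] -/
theorem isSymm_iff_swapW_eq (hϱ : 1 ≤ ϱ) (u : Wiener (coneSubmultWeight hϱ)) :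
    IsSymm u ↔ swapW hϱ u = u := by
  constructor
  · intro h
    refine Subtype.ext ?_
    ext n
    exact h n
  · intro h n
    have := congrArg (fun w => cf w n) h
    simpa using this

/-- `σ` is an involution. [cite: ArioliKoch2019, §3 eq. (3.3)] -/
@[simp] theorem swapW_swapW (hϱ : 1 ≤ ϱ) (u : Wiener (coneSubmultWeight hϱ)) : swapW hϱ (swapW hϱ u) = u := by
  refine Subtype.ext ?_; ext n
  show cf (swapW hϱ (swapW hϱ u)) n = cf u n
  rw [cf_swapW, cf_swapW, swapIdx_swapIdx]

/-- `σ` is additive. [cite: ArioliKoch2019, §4 Lemma 4.3 (S linear)] -/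
theorem swapW_add (hϱ : 1 ≤ ϱ) (u v : Wiener (coneSubmultWeight hϱ)) :
    swapW hϱ (u + v) = swapW hϱ u + swapW hϱ v := by
  refine Subtype.ext ?_; ext n
  show cf (swapW hϱ (u + v)) n = cf (swapW hϱ u + swapW hϱ v) n
  rw [cf_add, cf_swapW, cf_swapW, cf_swapW, cf_add]

/-- `σ` commutes with subtraction. [cite: ArioliKoch2019, §4 Lemma 4.3 (S linear)] -/
theorem swapW_sub (hϱ : 1 ≤ ϱ) (u v : Wiener (coneSubmultWeight hϱ)) :
    swapW hϱ (u - v) = swapW hϱ u - swapW hϱ v := by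
  refine Subtype.ext ?_; ext n
  show cf (swapW hϱ (u - v)) n = cf (swapW hϱ u - swapW hϱ v) n
  have e : ∀ (a b : Wiener (coneSubmultWeight hϱ)) (m : Fin 2 →₀ ℕ), cf (a - b) m = cf a m - cf b m := by
    intro a b m; unfold cf; rw [Subalgebra.coe_sub, map_sub]
  rw [e, cf_swapW, cf_swapW, cf_swapW, e]

/-- `σ 0 = 0`. [cite: ArioliKoch2019, §4 Lemma 4.3] -/
@[simp] theorem swapW_zero (hϱ : 1 ≤ ϱ) : swapW hϱ (0 : Wiener (coneSubmultWeight hϱ)) = 0 := by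
  refine Subtype.ext ?_; ext n
  show cf (0 : Wiener (coneSubmultWeight hϱ)) (swapIdx n)
    = MvPowerSeries.coeff n ((0 : Wiener (coneSubmultWeight hϱ)) : MvPowerSeries (Fin 2) ℝ)
  unfold cf
  rw [Subalgebra.coe_zero, MvPowerSeries.coeff_zero, MvPowerSeries.coeff_zero]

/-- **`σ` is multiplicative:** the Cauchy product is swap-equivariant (the swap permutes the antidiagonals).
[cite: ArioliKoch2019, §4 Lemma 4.3 (S is an algebra symmetry) with §3 eq. (3.4)] -/
theorem swapW_mul (hϱ : 1 ≤ ϱ) (u v : Wiener (coneSubmultWeight hϱ)) :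
    swapW hϱ (u * v) = swapW hϱ u * swapW hϱ v := by
  classical
  refine Subtype.ext ?_; ext n
  show cf (swapW hϱ (u * v)) n = cf (swapW hϱ u * swapW hϱ v) n
  rw [cf_swapW, cf_mul, cf_mul]
  simp only [cf_swapW]
  -- Σ over antidiagonal (swap n) of u_p v_q  =  Σ over antidiagonal n of u_{swap p} v_{swap q}
  refine Finset.sum_nbij' (fun pq => (swapIdx pq.1, swapIdx pq.2)) (fun pq => (swapIdx pq.1, swapIdx pq.2))
    ?_ ?_ ?_ ?_ ?_
  · intro pq hpq
    rw [Finset.HasAntidiagonal.mem_antidiagonal] at hpq ⊢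
    rw [← swapIdx_add, hpq, swapIdx_swapIdx]
  · intro pq hpq
    rw [Finset.HasAntidiagonal.mem_antidiagonal] at hpq ⊢
    rw [← swapIdx_add, hpq]
  · intro pq _; simp
  · intro pq _; simp
  · intro pq _; simp

/-- `σ` preserves powers. [cite: ArioliKoch2019, §4 Lemma 4.3] -/
theorem swapW_pow (hϱ : 1 ≤ ϱ) (u : Wiener (coneSubmultWeight hϱ)) (k : ℕ) :
    swapW hϱ (u ^ k) = swapW hϱ u ^ k := by
  induction k with
  | zero =>
    rw [pow_zero, pow_zero]
    refine Subtype.ext ?_; ext n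
    show cf (swapW hϱ 1) n = cf (1 : Wiener (coneSubmultWeight hϱ)) n
    rw [cf_swapW, cf_one, cf_one]
    by_cases h : n = 0
    · subst h; simp
    · have h' : swapIdx n ≠ 0 := fun e => h (by rw [← swapIdx_swapIdx n, e, swapIdx_zero])
      rw [if_neg h', if_neg h]
  | succ k ih => rw [pow_succ, pow_succ, swapW_mul, ih]

/-- `σ` preserves the norm. [cite: ArioliKoch2019, §4 Lemma 4.3 (S isometric); §3 eq. (3.2)] -/
theorem norm_swapW (hϱ : 1 ≤ ϱ) (u : Wiener (coneSubmultWeight hϱ)) : ‖swapW hϱ u‖ = ‖u‖ := by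
  rw [norm_eq_wnorm_cf, norm_eq_wnorm_cf]
  unfold wnorm
  simp only [cf_swapW]
  calc ∑' n, |cf u (swapIdx n)| * (coneSubmultWeight hϱ).toFun n
      = ∑' n, |cf u (swapIdx n)| * (coneSubmultWeight hϱ).toFun (swapIdx n) :=
        tsum_congr fun n => by rw [coneWeight_swapIdx]
    _ = ∑' n, |cf u n| * (coneSubmultWeight hϱ).toFun n :=
        swapEquiv.tsum_eq (fun n => |cf u n| * (coneSubmultWeight hϱ).toFun n)

/-! ### §4. The swap commutes with the Dirichlet inverse -/

/-- Raising commutes with the swap. [cite: ArioliKoch2019, §2 Lemma 2.1] -/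
theorem raise_swap (p : ℕ × ℕ) : raise p.swap = (raise p).swap := rfl

/-- The harmonic correction of `(b, a)` is the swap of that of `(a, b)`.
[cite: ArioliKoch2019, §2 Lemma 2.1 (z ↔ z̄ symmetry of the inverse)] -/
theorem harmIndex_swap (p : ℕ × ℕ) : harmIndex p.swap = (harmIndex p).swap := by
  unfold harmIndex
  rcases p with ⟨a, b⟩
  simp only [Prod.swap_prod_mk]
  split_ifs with h1 h2 h2
  · have : a = b := le_antisymm h1 h2
    subst this; simp
  · rfl
  · rfl
  · omega

/-- The column factor is symmetric. [cite: ArioliKoch2019, §2 Lemma 2.1] -/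
theorem invFactor_swap (p : ℕ × ℕ) : invFactor p.swap = invFactor p := by
  unfold invFactor; rcases p with ⟨a, b⟩; simp only [Prod.swap_prod_mk]; ring

/-- The Dirichlet-inverse kernel is swap-invariant: `Δ_D⁻¹(σk, σm) = Δ_D⁻¹(k, m)` (raising commutes with the
swap, the harmonic correction of `(b,a)` is the swap of that of `(a,b)`, the factor is symmetric).
[cite: ArioliKoch2019, §2 Lemma 2.1 (the inverse treats z and z̄ symmetrically)] -/
theorem dirKer_swap (k m : Fin 2 →₀ ℕ) : dirKer (swapIdx k) (swapIdx m) = dirKer k m := by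
  unfold dirKer dirichletInvKer
  rw [idx_swapIdx, idx_swapIdx, raise_swap, harmIndex_swap, invFactor_swap]
  simp only [Prod.swap_inj]

/-- **`σ ∘ Δ_D⁻¹ = Δ_D⁻¹ ∘ σ`.** [cite: ArioliKoch2019, §4 Lemma 4.3 (the operator commutes with the symmetry)] -/
theorem swapW_dirInv (hϱ : 1 ≤ ϱ) (u : Wiener (coneSubmultWeight hϱ)) :
    swapW hϱ (dirInv hϱ u) = dirInv hϱ (swapW hϱ u) := by
  refine Subtype.ext ?_; ext k
  show cf (swapW hϱ (dirInv hϱ u)) k = cf (dirInv hϱ (swapW hϱ u)) k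
  rw [cf_swapW]
  unfold cf
  rw [coeff_dirInv, coeff_dirInv]
  unfold apply
  have e : (fun m => dirKer k m * coeffFun ((swapW hϱ u : Wiener (coneSubmultWeight hϱ)) :
      MvPowerSeries (Fin 2) ℝ) m) = fun m => dirKer k m * cf u (swapIdx m) := rfl
  rw [e]
  calc ∑' m, dirKer (swapIdx k) m * coeffFun (u : MvPowerSeries (Fin 2) ℝ) m
      = ∑' m, dirKer (swapIdx k) (swapIdx m) * cf u (swapIdx m) :=
        (swapEquiv.tsum_eq (fun m => dirKer (swapIdx k) m * coeffFun (u : MvPowerSeries (Fin 2) ℝ) m)).symm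
    _ = ∑' m, dirKer k m * cf u (swapIdx m) := tsum_congr fun m => by rw [dirKer_swap]

/-! ### §5. Symmetric data give a symmetric — hence real — zero -/

/-- **The (B-SL) map is swap-equivariant** for symmetric data `v, c_k, g`.
[cite: ArioliKoch2019, §4 Lemma 4.3 (N commutes with S when ū, M do)] -/
theorem swapW_semilinMap (hϱ : 1 ≤ ϱ) {v g : Wiener (coneSubmultWeight hϱ)}
    {c : ℕ → Wiener (coneSubmultWeight hϱ)} {m : ℕ} (hv : IsSymm v) (hg : IsSymm g)
    (hc : ∀ k, IsSymm (c k)) (x : Wiener (coneSubmultWeight hϱ)) :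
    swapW hϱ (Literature.Analysis.Calculus.PolynomialNonlinearity.semilinMap (dirInv hϱ) v c m g x)
      = Literature.Analysis.Calculus.PolynomialNonlinearity.semilinMap (dirInv hϱ) v c m g (swapW hϱ x) := by
  have hv' := (isSymm_iff_swapW_eq hϱ v).1 hv
  have hg' := (isSymm_iff_swapW_eq hϱ g).1 hg
  -- the polynomial part
  have hsum : ∀ (s : Finset ℕ), swapW hϱ (∑ k ∈ s, c k * x ^ k) = ∑ k ∈ s, c k * swapW hϱ x ^ k := by
    intro s
    induction s using Finset.induction_on with
    | empty => simp
    | insert a s ha ih =>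
      rw [Finset.sum_insert ha, Finset.sum_insert ha, swapW_add, ih, swapW_mul, swapW_pow,
        (isSymm_iff_swapW_eq hϱ (c a)).1 (hc a)]
  unfold Literature.Analysis.Calculus.PolynomialNonlinearity.semilinMap
    Literature.Analysis.Calculus.PolynomialNonlinearity.polyMap
  rw [swapW_sub, swapW_sub, hg', swapW_dirInv, swapW_add, swapW_mul, hv', hsum]

/-- **Symmetric data, symmetric zero:** if `x` is the unique zero of the (B-SL) map in a closed ball centred
at a symmetric `x̄` (the uniqueness clause of `ConeSemilinear.cone_existsUnique_zero_of_semilin`) and the data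
`v, c_k, g` are symmetric, then `x` is symmetric.
[cite: ArioliKoch2019, §4 Lemma 4.3 (invariance of the solution under the symmetry, from uniqueness)] -/
theorem isSymm_of_unique_zero (hϱ : 1 ≤ ϱ) {v g xbar x : Wiener (coneSubmultWeight hϱ)}
    {c : ℕ → Wiener (coneSubmultWeight hϱ)} {m : ℕ} {r : ℝ} (hv : IsSymm v) (hg : IsSymm g)
    (hc : ∀ k, IsSymm (c k)) (hxbar : IsSymm xbar) (hx : x ∈ Metric.closedBall xbar r)
    (hzero : Literature.Analysis.Calculus.PolynomialNonlinearity.semilinMap (dirInv hϱ) v c m g x = 0)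
    (huniq : ∀ y ∈ Metric.closedBall xbar r,
      Literature.Analysis.Calculus.PolynomialNonlinearity.semilinMap (dirInv hϱ) v c m g y = 0 → y = x) :
    IsSymm x := by
  rw [isSymm_iff_swapW_eq]
  refine huniq _ ?_ ?_
  · rw [Metric.mem_closedBall, dist_eq_norm] at hx ⊢
    rw [← (isSymm_iff_swapW_eq hϱ xbar).1 hxbar, ← swapW_sub, norm_swapW]
    exact hx
  · rw [← swapW_semilinMap hϱ hv hg hc x, hzero, swapW_zero]

/-- **The certificate's zero represents a real function** (symmetric data and centre).
[cite: ArioliKoch2019, §3 eq. (3.3) with §4 Lemma 4.3] -/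
theorem im_eval_zero_eq_zero (hϱ : 1 ≤ ϱ) {v g xbar x : Wiener (coneSubmultWeight hϱ)}
    {c : ℕ → Wiener (coneSubmultWeight hϱ)} {m : ℕ} {r : ℝ} (hv : IsSymm v) (hg : IsSymm g)
    (hc : ∀ k, IsSymm (c k)) (hxbar : IsSymm xbar) (hx : x ∈ Metric.closedBall xbar r)
    (hzero : Literature.Analysis.Calculus.PolynomialNonlinearity.semilinMap (dirInv hϱ) v c m g x = 0)
    (huniq : ∀ y ∈ Metric.closedBall xbar r,
      Literature.Analysis.Calculus.PolynomialNonlinearity.semilinMap (dirInv hϱ) v c m g y = 0 → y = x)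
    (ζ : ℂ) : (eval hϱ x ζ).im = 0 :=
  im_eval_eq_zero hϱ (isSymm_of_unique_zero hϱ hv hg hc hxbar hx hzero huniq) ζ

end ConeEval

end Literature.Analysis.ValidatedNumerics
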